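import Literature.Topology.FourManifolds.CircleSurgeryExistence
import Literature.Topology.FourManifolds.GluingUniqueness
import HarnessLib

/-!
# Circle surgery is local: a diffeomorphism of open sets carrying tube to tube induces a
# diffeomorphism of the surgered manifolds off the untouched parts

Second brick (with `MappingTorusSliver.lean`) of the geometric core of R. Gompf, *More
Cappell–Shaneson spheres are standard*, Algebr. Geom. Topol. 10 (2010), Theorem 2.1, towards the
named facts `Literature.Topology.FourManifolds.gompf2010_framedTwist` /
`Literature.Topology.FourManifolds.gompf2010_framedTwistZero`. Gompf's proof cuts the *surgered*
mapping torus `X^ε_φ` along part of a fibre and reglues ("precede the surgery by cutting along an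
`M`-fiber and regluing by `δᵏ`"); to compare the two sides one needs that the circle surgery
(`CircleSurgeryExistence.lean`: `ν.Surgered`, the open gluing of `T ∖ c` and `D̊² × 𝕊²` along
`circleSurgeryRel ν`) only sees a neighbourhood of the tube. Precisely:

* `Literature.Topology.FourManifolds.CircleNbhd.localOpens ν U ⊆ ν.Surgered` — for an open set
  `U ⊆ T` containing the tube, the open subset `inl (U ∖ c) ∪ inr (D̊² × 𝕊²)` of the surgered
  manifold ("`U` surgered");
* `Literature.Topology.FourManifolds.CircleNbhd.exists_diffeomorph_localOpens` — **if
  `Θ : U ≅ U'` is a diffeomorphism between open subsets of two 4-manifolds `T`, `T'` carrying the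
  tube `ν` of the circle `c ⊂ U` to the tube `ν'` of `c' ⊂ U'` (`Θ ∘ ν = ν'`), then
  `Θ` induces a diffeomorphism `Ψ : localOpens ν U ≅ localOpens ν' U'` of the surgered open sets,
  with `Ψ (inl a) = inl' (Θ a)` on `U ∖ c` and `Ψ (inr d) = inr' d` on `D̊² × 𝕊²`.**

The comparison map is the set-theoretic map between the two gluings
(`IsOpenGluing.exists_map_apply_eq`); it is smooth on `localOpens ν U` by descent of smoothness
along the open embeddings `inl`, `inr` (`contMDiffAt_of_comp_isImmersionAt`, Kosinski VI.1), and
its inverse is the same construction for `Θ⁻¹`. This is the folklore statement that surgery on a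
framed circle is a local operation / natural under diffeomorphisms of pairs (Gompf–Stipsicz,
*4-Manifolds and Kirby Calculus*, §5.2; the ambient-diffeomorphism case is
`Literature.Topology.FourManifolds.CircleNbhd.nonempty_diffeomorph_surgered_map` of
`GompfConjInvariance.lean`). No named facts are introduced; everything is proved.

## References

* R. E. Gompf, *More Cappell–Shaneson spheres are standard*, Algebr. Geom. Topol. 10 (2010)
  1665–1681: proof of Thm 2.1, last paragraph. [GompfAGT2010]
* R. E. Gompf, A. I. Stipsicz, *4-Manifolds and Kirby Calculus*, GSM 20 (1999), §5.2 (surgery on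
  an embedded circle). [GompfStipsiczGSM1999]
* A. Kosinski, *Differential Manifolds* (1993), Ch. VI §1. [Kosinski1993]
-/

open scoped Manifold ContDiff Topology
open Set Function

noncomputable section

namespace Literature.Topology.FourManifolds

universe u

/-- Local notation: `𝔼 n` is the model Euclidean space `EuclideanSpace ℝ (Fin n)`. -/
local notation "𝔼 " n:arg => EuclideanSpace ℝ (Fin n)

/-- Local notation: `𝕊 n` is the unit sphere in `EuclideanSpace ℝ (Fin (n + 1))`. -/
local notation "𝕊 " n:arg => (Metric.sphere (0 : EuclideanSpace ℝ (Fin (n + 1))) 1)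

attribute [local instance] fact_finrank_euclideanSpace_succ

/-! ### Extending a map on an open subset by a junk value -/

section Extend

variable {M : Type*} [TopologicalSpace M] {N : Type*}

open Classical in
/-- Extension of a map defined on an open subset `U ⊆ M` to all of `M` by a junk value. [folklore] -/
def opensExtend (U : TopologicalSpace.Opens M) (f : ↥U → N) (junk : N) (x : M) : N :=
  if h : x ∈ U then f ⟨x, h⟩ else junk

/-- On `U` the extension is the given map. [folklore] -/
theorem opensExtend_of_mem {U : TopologicalSpace.Opens M} (f : ↥U → N) (junk : N) {x : M}
    (h : x ∈ U) : opensExtend U f junk x = f ⟨x, h⟩ := by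
  unfold opensExtend
  rw [dif_pos h]

/-- Off `U` the extension is the junk value. [folklore] -/
theorem opensExtend_of_not_mem {U : TopologicalSpace.Opens M} (f : ↥U → N) (junk : N) {x : M}
    (h : x ∉ U) : opensExtend U f junk x = junk := by
  unfold opensExtend
  rw [dif_neg h]

/-- On `U` the extension is the given map (subtype form). [folklore] -/
@[simp] theorem opensExtend_coe {U : TopologicalSpace.Opens M} (f : ↥U → N) (junk : N) (x : ↥U) :
    opensExtend U f junk x = f x := by
  rw [opensExtend_of_mem f junk x.2]

variable {EM HM : Type*} [NormedAddCommGroup EM] [NormedSpace ℝ EM] [TopologicalSpace HM]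
  {IM : ModelWithCorners ℝ EM HM} [ChartedSpace HM M]
  {EN HN : Type*} [NormedAddCommGroup EN] [NormedSpace ℝ EN] [TopologicalSpace HN]
  {IN : ModelWithCorners ℝ EN HN} [TopologicalSpace N] [ChartedSpace HN N]

/-- The extension of a smooth map is smooth at the points of `U`. [folklore] -/
theorem contMDiffAt_opensExtend {U : TopologicalSpace.Opens M} {f : ↥U → N}
    (hf : ContMDiff IM IN ∞ f) (junk : N) {x : M} (hx : x ∈ U) :
    ContMDiffAt IM IN ∞ (opensExtend U f junk) x := by
  rw [← contMDiffAt_subtype_iff (U := U) (x := ⟨x, hx⟩)]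
  have heq : (fun y : ↥U ↦ opensExtend U f junk y) = f := funext fun y ↦ opensExtend_coe f junk y
  rw [heq]
  exact hf _

end Extend

/-! ### Surgery off the untouched part -/

namespace CircleNbhd

variable {T : Type u} [TopologicalSpace T] [ChartedSpace (𝔼 4) T] {c : 𝕊 1 → T}
  (ν : CircleNbhd (𝓡 4) c)
  {T' : Type u} [TopologicalSpace T'] [ChartedSpace (𝔼 4) T'] {c' : 𝕊 1 → T'}
  (ν' : CircleNbhd (𝓡 4) c')
  {U : TopologicalSpace.Opens T} {U' : TopologicalSpace.Opens T'}
  (Θ : ↥U ≃ₘ⟮𝓡 4, 𝓡 4⟯ ↥U') (hνU : ∀ q, ν.toFun q ∈ U)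
  (hΘν : ∀ q, ((Θ ⟨ν.toFun q, hνU q⟩ : ↥U') : T') = ν'.toFun q)

/-- A point of `T'` off the circle `c'`: `ν' (pt, w₀)` with `w₀ ≠ 0` (junk value for the extension
of `Θ`). [folklore] -/
def junkPt : T' := ν'.toFun (spherePt 1, halfVec)

/-- The junk point is off the circle. [folklore] -/
theorem junkPt_not_mem : ν'.junkPt ∉ range c' := by
  rw [junkPt, ν'.apply_mem_range_iff]
  exact halfVec_ne_zero

/-- `Θ` extended to `T → T'` (junk off `U`). [folklore] -/
def extendMap : T → T' :=
  opensExtend U (fun x ↦ ((Θ x : ↥U') : T')) ν'.junkPt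

/-- On `U`, `extendMap` is `Θ`. [folklore] -/
theorem extendMap_of_mem {x : T} (hx : x ∈ U) :
    extendMap ν' Θ x = ((Θ ⟨x, hx⟩ : ↥U') : T') :=
  opensExtend_of_mem _ _ hx

/-- Off `U`, `extendMap` is the junk point. [folklore] -/
theorem extendMap_of_not_mem {x : T} (hx : x ∉ U) : extendMap ν' Θ x = ν'.junkPt :=
  opensExtend_of_not_mem _ _ hx

include hΘν in
/-- On the tube, `extendMap` is `ν' ∘ ν⁻¹`. [folklore] -/
theorem extendMap_apply_tube (q : (𝕊 1) × (𝔼 3)) : extendMap ν' Θ (ν.toFun q) = ν'.toFun q := by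
  rw [extendMap_of_mem ν' Θ (hνU q), hΘν]

/-- `extendMap` is smooth at the points of `U`. [folklore] -/
theorem contMDiffAt_extendMap {x : T} (hx : x ∈ U) : ContMDiffAt (𝓡 4) (𝓡 4) ∞ (extendMap ν' Θ) x :=
  contMDiffAt_opensExtend (contMDiff_subtype_val.comp Θ.contMDiff) _ hx

include hΘν in
/-- `extendMap` maps the complement of `c` to the complement of `c'`. [folklore] -/
theorem extendMap_not_mem_range {x : T} (hx : x ∉ range c) : extendMap ν' Θ x ∉ range c' := by
  by_cases hxU : x ∈ U
  · rw [extendMap_of_mem ν' Θ hxU]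
    rintro ⟨u, hu⟩
    rw [← ν'.apply_zero u, ← hΘν (u, 0)] at hu
    have h1 : (⟨ν.toFun (u, 0), hνU (u, 0)⟩ : ↥U) = ⟨x, hxU⟩ := Θ.injective (Subtype.ext hu)
    refine hx ⟨u, ?_⟩
    rw [← ν.apply_zero u]
    exact congrArg Subtype.val h1
  · rw [extendMap_of_not_mem ν' Θ hxU]
    exact ν'.junkPt_not_mem

include hΘν in
/-- The transported tube lies in `U'`. [folklore] -/
theorem apply_mem_of_transport (q : (𝕊 1) × (𝔼 3)) : ν'.toFun q ∈ U' := by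
  rw [← hΘν q]
  exact (Θ _).2

/-- `Θ⁻¹` carries `ν'` back to `ν`. [folklore] -/
theorem symm_transport (q : (𝕊 1) × (𝔼 3)) :
    ((Θ.symm ⟨ν'.toFun q, apply_mem_of_transport ν ν' Θ hνU hΘν q⟩ : ↥U) : T) = ν.toFun q := by
  have h1 : (⟨ν'.toFun q, apply_mem_of_transport ν ν' Θ hνU hΘν q⟩ : ↥U') =
      Θ ⟨ν.toFun q, hνU q⟩ :=
    Subtype.ext (hΘν q).symm
  rw [h1, Diffeomorph.symm_apply_apply]

variable [T2Space T] [T2Space T']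

/-- **"`U` surgered"**: for an open set `U ⊆ T` (containing the tube, in the applications), the
open subset `inl (U ∖ c) ∪ inr (D̊² × 𝕊²)` of the surgered manifold `ν.Surgered`. [folklore] -/
def localOpens (U : TopologicalSpace.Opens T) : TopologicalSpace.Opens ν.Surgered :=
  ⟨ν.glueData.inl '' {a : ↥ν.complement | (a : T) ∈ U} ∪ range ν.glueData.inr,
    (ν.glueData.isOpenMap_inl _ (U.2.preimage continuous_subtype_val)).union
      ν.glueData.isOpen_range_inr⟩

/-- Membership in `localOpens`. [folklore] -/
theorem mem_localOpens_iff {U : TopologicalSpace.Opens T} {p : ν.Surgered} :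
    p ∈ ν.localOpens U ↔
      (∃ a : ↥ν.complement, (a : T) ∈ U ∧ ν.glueData.inl a = p) ∨ ∃ d, ν.glueData.inr d = p := by
  simp only [localOpens, TopologicalSpace.Opens.mem_mk, mem_union, mem_image, mem_setOf_eq,
    mem_range]

/-- `inl a ∈ localOpens ν U` for `a ∈ U`. [folklore] -/
theorem inl_mem_localOpens {U : TopologicalSpace.Opens T} {a : ↥ν.complement} (ha : (a : T) ∈ U) :
    ν.glueData.inl a ∈ ν.localOpens U :=
  Or.inl ⟨a, ha, rfl⟩

/-- `inr d ∈ localOpens ν U`. [folklore] -/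
theorem inr_mem_localOpens {U : TopologicalSpace.Opens T} (d : ↥discTimesSphere) :
    ν.glueData.inr d ∈ ν.localOpens U :=
  Or.inr ⟨d, rfl⟩

/-- `Θ` on the complements of the circles: `(T ∖ c) → (T' ∖ c')` (junk off `U`). [folklore] -/
def complementExtend (a : ↥ν.complement) : ↥ν'.complement :=
  ⟨extendMap ν' Θ a, (ν'.mem_complement_iff _).2
    (extendMap_not_mem_range ν ν' Θ hνU hΘν ((ν.mem_complement_iff _).1 a.2))⟩

/-- The value of `complementExtend`. [folklore] -/
@[simp] theorem coe_complementExtend (a : ↥ν.complement) :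
    (complementExtend ν ν' Θ hνU hΘν a : T') = extendMap ν' Θ a := rfl

/-- `complementExtend` is smooth at the points of `U`. [folklore] -/
theorem contMDiffAt_complementExtend {a : ↥ν.complement} (ha : (a : T) ∈ U) :
    ContMDiffAt (𝓡 4) (𝓡 4) ∞ (complementExtend ν ν' Θ hνU hΘν) a := by
  rw [← ContMDiffAt.subtypeVal_comp_iff]
  exact (contMDiffAt_extendMap ν' Θ ha).comp a contMDiff_subtype_val.contMDiffAt

/-- The comparison map sends `localOpens ν U` into `localOpens ν' U'`. [folklore] -/
theorem localMap_mem {G : ν.Surgered → ν'.Surgered}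
    (hGl : ∀ a, G (ν.glueData.inl a) = ν'.glueData.inl (complementExtend ν ν' Θ hνU hΘν a))
    (hGr : ∀ d, G (ν.glueData.inr d) = ν'.glueData.inr d) {p : ν.Surgered}
    (hp : p ∈ ν.localOpens U) : G p ∈ ν'.localOpens U' := by
  rcases (ν.mem_localOpens_iff).1 hp with ⟨a, ha, rfl⟩ | ⟨d, rfl⟩
  · rw [hGl]
    refine ν'.inl_mem_localOpens ?_
    rw [coe_complementExtend, extendMap_of_mem ν' Θ ha]
    exact (Θ _).2
  · rw [hGr]
    exact ν'.inr_mem_localOpens d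

variable [IsManifold (𝓡 4) ∞ T] [IsManifold (𝓡 4) ∞ T']

/-- **The comparison map of the surgered manifolds, set-theoretically**: `inl a ↦ inl' (Θ a)`,
`inr d ↦ inr' d` is well defined since `Θ ∘ ν = ν'` intertwines the surgery relations. [folklore] -/
theorem exists_localMap :
    ∃ G : ν.Surgered → ν'.Surgered,
      (∀ a, G (ν.glueData.inl a) = ν'.glueData.inl (complementExtend ν ν' Θ hνU hΘν a)) ∧
        ∀ d, G (ν.glueData.inr d) = ν'.glueData.inr d := by
  have hW := ν.glueData.isOpenGluingWith ν.circleSurgeryRel_iff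
  have hW' := ν'.glueData.isOpenGluingWith ν'.circleSurgeryRel_iff
  obtain ⟨G, hGl, hGr⟩ := IsOpenGluing.exists_map_apply_eq
    (jA' := ν'.glueData.inl ∘ complementExtend ν ν' Θ hνU hΘν) (jB' := ν'.glueData.inr)
    ν.glueData.range_inl_union_range_inr ν.glueData.inl_injective ν.glueData.inr_injective
    fun a d had ↦ by
      obtain ⟨w, t, ht, hd, ha⟩ := (hW.2.2.2.2.2 a d).1 had
      rw [comp_apply, hW'.2.2.2.2.2]
      refine ⟨w, t, ht, hd, ?_⟩
      rw [coe_complementExtend, ha, extendMap_apply_tube ν ν' Θ hνU hΘν]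
  exact ⟨G, hGl, hGr⟩

/-- **The comparison map is smooth on `localOpens ν U`** (descent of smoothness along `inl`,
`inr`). [cite: Kosinski1993, Ch. VI §1, proof of Thm (1.1)] -/
theorem contMDiffAt_localMap {G : ν.Surgered → ν'.Surgered}
    (hGl : ∀ a, G (ν.glueData.inl a) = ν'.glueData.inl (complementExtend ν ν' Θ hνU hΘν a))
    (hGr : ∀ d, G (ν.glueData.inr d) = ν'.glueData.inr d) {p : ν.Surgered}
    (hp : p ∈ ν.localOpens U) : ContMDiffAt (𝓡 4) (𝓡 4) ∞ G p := by
  rcases (ν.mem_localOpens_iff).1 hp with ⟨a, ha, rfl⟩ | ⟨d, rfl⟩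
  · exact contMDiffAt_of_comp_isImmersionAt
      (ν.glueData.isSmoothEmbedding_inl.isImmersion.isImmersionAt a) ν.glueData.isOpenMap_inl
      (ν'.glueData.contMDiff_inl.contMDiffAt.comp a
        (contMDiffAt_complementExtend ν ν' Θ hνU hΘν ha)) hGl
  · exact contMDiffAt_of_comp_isImmersionAt
      (ν.glueData.isSmoothEmbedding_inr.isImmersion.isImmersionAt d) ν.glueData.isOpenMap_inr
      ν'.glueData.contMDiff_inr.contMDiffAt hGr

/-- **Surgery is local: a diffeomorphism `Θ : U ≅ U'` of open sets with `Θ ∘ ν = ν'` induces a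
diffeomorphism of the surgered open sets `inl (U ∖ c) ∪ inr (D̊² × 𝕊²) ≅ inl' (U' ∖ c') ∪
inr' (D̊² × 𝕊²)`**, equal to `inl' ∘ Θ ∘ inl⁻¹` on the first part and to `inr' ∘ inr⁻¹` on the
second. (Gompf–Stipsicz §5.2: surgery on a framed circle only depends on a neighbourhood of the
framed circle; here in the relative form needed to compare a surgered manifold with a cut-and-
reglued copy of itself, Gompf 2010, proof of Thm 2.1.) [cite: GompfStipsiczGSM1999, §5.2] -/
theorem exists_diffeomorph_localOpens :
    ∃ Ψ : ↥(ν.localOpens U) ≃ₘ⟮𝓡 4, 𝓡 4⟯ ↥(ν'.localOpens U'),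
      (∀ (x : ↥(ν.localOpens U)) (a : ↥ν.complement), (x : ν.Surgered) = ν.glueData.inl a →
          (Ψ x : ν'.Surgered) = ν'.glueData.inl (complementExtend ν ν' Θ hνU hΘν a)) ∧
        ∀ (x : ↥(ν.localOpens U)) (d : ↥discTimesSphere), (x : ν.Surgered) = ν.glueData.inr d →
          (Ψ x : ν'.Surgered) = ν'.glueData.inr d := by
  -- the symmetric data for `Θ⁻¹`
  have hν'U' : ∀ q, ν'.toFun q ∈ U' := apply_mem_of_transport ν ν' Θ hνU hΘν
  have hΘ'ν : ∀ q, ((Θ.symm ⟨ν'.toFun q, hν'U' q⟩ : ↥U) : T) = ν.toFun q :=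
    symm_transport ν ν' Θ hνU hΘν
  obtain ⟨G, hGl, hGr⟩ := exists_localMap ν ν' Θ hνU hΘν
  obtain ⟨G', hGl', hGr'⟩ := exists_localMap ν' ν Θ.symm hν'U' hΘ'ν
  have hmem : ∀ p, p ∈ ν.localOpens U → G p ∈ ν'.localOpens U' :=
    fun p hp ↦ localMap_mem ν ν' Θ hνU hΘν hGl hGr hp
  have hmem' : ∀ p, p ∈ ν'.localOpens U' → G' p ∈ ν.localOpens U :=
    fun p hp ↦ localMap_mem ν' ν Θ.symm hν'U' hΘ'ν hGl' hGr' hp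
  -- `Θ⁻¹ ∘ Θ = id` on the complements, over `U`
  have hcc : ∀ a : ↥ν.complement, (a : T) ∈ U →
      complementExtend ν' ν Θ.symm hν'U' hΘ'ν (complementExtend ν ν' Θ hνU hΘν a) = a := by
    intro a ha
    apply Subtype.ext
    rw [coe_complementExtend, coe_complementExtend, extendMap_of_mem ν' Θ ha,
      extendMap_of_mem ν Θ.symm (Θ _).2]
    simp only [Subtype.coe_eta, Diffeomorph.symm_apply_apply]
  have hcc' : ∀ a' : ↥ν'.complement, (a' : T') ∈ U' →
      complementExtend ν ν' Θ hνU hΘν (complementExtend ν' ν Θ.symm hν'U' hΘ'ν a') = a' := by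
    intro a' ha'
    apply Subtype.ext
    rw [coe_complementExtend, coe_complementExtend, extendMap_of_mem ν Θ.symm ha',
      extendMap_of_mem ν' Θ (Θ.symm _).2]
    simp only [Subtype.coe_eta, Diffeomorph.apply_symm_apply]
  have hleft : ∀ p, p ∈ ν.localOpens U → G' (G p) = p := fun p hp ↦ by
    rcases (ν.mem_localOpens_iff).1 hp with ⟨a, ha, rfl⟩ | ⟨d, rfl⟩
    · rw [hGl, hGl', hcc a ha]
    · rw [hGr, hGr']
  have hright : ∀ p, p ∈ ν'.localOpens U' → G (G' p) = p := fun p hp ↦ by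
    rcases (ν'.mem_localOpens_iff).1 hp with ⟨a', ha', rfl⟩ | ⟨d, rfl⟩
    · rw [hGl', hGl, hcc' a' ha']
    · rw [hGr', hGr]
  refine ⟨{ toFun := fun x ↦ ⟨G x, hmem x x.2⟩
            invFun := fun x' ↦ ⟨G' x', hmem' x' x'.2⟩
            left_inv := fun x ↦ Subtype.ext (hleft x x.2)
            right_inv := fun x' ↦ Subtype.ext (hright x' x'.2)
            contMDiff_toFun := ?_
            contMDiff_invFun := ?_ }, fun x a hx ↦ ?_, fun x d hx ↦ ?_⟩
  · rw [← ContMDiff.subtypeVal_comp_iff]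
    intro x
    show ContMDiffAt (𝓡 4) (𝓡 4) ∞ (fun x : ↥(ν.localOpens U) ↦ G x) x
    rw [contMDiffAt_subtype_iff]
    exact contMDiffAt_localMap ν ν' Θ hνU hΘν hGl hGr x.2
  · rw [← ContMDiff.subtypeVal_comp_iff]
    intro x'
    show ContMDiffAt (𝓡 4) (𝓡 4) ∞ (fun x' : ↥(ν'.localOpens U') ↦ G' x') x'
    rw [contMDiffAt_subtype_iff]
    exact contMDiffAt_localMap ν' ν Θ.symm hν'U' hΘ'ν hGl' hGr' x'.2
  · show G x = _
    rw [hx, hGl]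
  · show G x = _
    rw [hx, hGr]

end CircleNbhd

end Literature.Topology.FourManifolds
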